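import Mathlib
import Summits.AnomalousDissipation.AnomalousDissipation.Theses.PointSink
import Summits.AnomalousDissipation.AnomalousDissipation.Theorems.SolitonTransplant.Negative.PointSinkLocalEnergy
import Summits.AnomalousDissipation.AnomalousDissipation.Theorems.SolitonTransplant.Negative.PointSinkLqEstimates
import Summits.AnomalousDissipation.AnomalousDissipation.Theorems.NegSteadyThinSetLiouvilleCutoff
import Summits.AnomalousDissipation.AnomalousDissipation.Theorems.CoherentStatesSteadyNegTameOffThinSets

/-!
# No point sink in `L^q`, `q > 9/2` — the Onsager/Galdi-critical integrability barrier of the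
target `PointSinkZerothLaw`, kernel-checked (negative lemma for the crux
`PointSink.SolitonTransplant`, stmt-AnomalousDissipation-19035; conclusion = stmt-19032)

cdisprove record (route `AnomalousDissipation/PointSink`). The crux is
`CascadeSoliton → PointSinkZerothLaw`; its conclusion `X` asks for steady classical states
`(u_j, p_j)` of the `f`-forced Navier–Stokes system on `T³` (`f` smooth and FIXED), `ν_j → 0`,
`∫‖u_j‖² ≤ E`, a dissipation floor `ε ≤ ν_j‖∇u_j‖₂²`, and ALL dissipation concentrating at one
point `x₀` (`ν_j∫_{dist ≥ r}|∇u_j|² → 0` for every `r > 0`).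

* `pointSink_dissipationFloor_false_of_LqBound` — for every `q > 9/2`, such a family can NOT be
  bounded in `L^q × L^{q/2}`: `sup_j ∫‖u_j‖^q < ∞ ∧ sup_j ∫|p_j|^{q/2} < ∞` is impossible. Proof:
  the weighted steady energy identity (`steady_weighted_energy_identity`) with the cut-off of
  `ThinSetLiouville.exists_smooth_cutoff` adapted to `dist(·,x₀)` at scale `r`:
  `∫(½‖u_j‖²+p_j)Dχ[u_j] = ν_j∫χ∑‖∂ᵢu_j‖² + ν_j∫∑∂ᵢχ⟪u_j,∂ᵢu_j⟫ − ∫χ⟪f,u_j⟫`. By Hölder on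
  `B_{3r}(x₀)` (`|B_{3r}| ≤ 216r³`, `PointSinkLqEstimates.flux_abs_le_of_LqBound`) the flux is
  `≤ (3/2)C^{3/q} r⁻¹(216r³)^{1−3/q} ≍ r^{2−9/q} → 0` iff `q > 9/2`; the weighted dissipation is
  `≤ ν_j∫_{dist≥r/2}∑‖∂ᵢu_j‖² → 0` (concentration); the viscous transport is
  `≤ √ν_j(‖f‖_∞(1+E)/4 + 3E/(2r²)) → 0`; the work is `≥ ε − ‖f‖_∞√E√(216r³)`. Choosing `r` with
  total error `< ε/4` (it tends to `0` as `r → 0⁺`) forces `o_j ≥ 3ε/4` for a null sequence `o_j`.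
* `not_pointSinkZerothLaw_LqBounded` — packaged: the target `X` with the extra clause
  `∃ q > 9/2, ∃ C, ∀ j, ∫‖u_j‖^q ≤ C ∧ ∫|p_j|^{q/2} ≤ C` is FALSE (refuted natural strengthening;
  supersedes the bounded case `PointSinkBoundedNoGo`).

Reading for the provers/planner. The exponent is SHARP for the route's own witness: the
transplanted cascade soliton has `|u_j| ≍ dist^{-2/3}` on `ν_j³ ≲ dist ≲ 1`, which is bounded in
`L^q(T³)` uniformly in `j` exactly for `q < 9/2` (`∫ dist^{-2q/3}dist²d(dist) < ∞ ⟺ q < 9/2`) — the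
torus-side counterpart of the `L^{9/2}` borderline of Galdi's Liouville theorem (Thm X.9.5) and of
the degenerate endpoint `p = 9/2` of the De Rosa–Isett intermittency bound cited by the route: a
point energy sink fed by a smooth stirring must be at least as singular as the `-2/3` cone in the
`L^q` scale, for EVERY line of proof, not only the birth line. Classification: negative lemma /
refuted strengthening (no verdict change). [folklore]
-/

set_option linter.dupNamespace false  -- `Summit.AnomalousDissipation.AnomalousDissipation` is the mandated summit/problem namespace

noncomputable section

open MeasureTheory Metric Filter Topology Set
open scoped InnerProductSpace
open Literature.Analysis.FunctionSpaces Literature.Analysis.FunctionSpaces.Torus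

namespace Summit.AnomalousDissipation.AnomalousDissipation.Theorems.SolitonTransplant.Negative

open Summit.AnomalousDissipation.AnomalousDissipation.Theorems

/-- **No point sink with `L^q × L^{q/2}`-bounded states, `q > 9/2`.** [folklore] -/
theorem pointSink_dissipationFloor_false_of_LqBound
    (f : UnitAddTorus (Fin 3) → EuclideanSpace ℝ (Fin 3)) (hf : IsSmooth f)
    (x₀ : UnitAddTorus (Fin 3))
    (ν : ℕ → ℝ) (u : ℕ → UnitAddTorus (Fin 3) → EuclideanSpace ℝ (Fin 3))
    (p : ℕ → UnitAddTorus (Fin 3) → ℝ) (hν : ∀ j, 0 < ν j) (hν0 : Tendsto ν atTop (𝓝 0))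
    (hsol : ∀ j, IsClassicalNSSolutionOn Set.univ (ν j) (fun _ => f) (fun _ => u j)
      (fun _ => p j))
    (hE : ∃ E : ℝ, ∀ j, ∫ x, ‖u j x‖ ^ 2 ≤ E)
    (hconc : ∀ r : ℝ, 0 < r → Tendsto (fun j => ν j *
      ∫ x in {x : UnitAddTorus (Fin 3) | r ≤ dist x x₀}, ∑ i, ‖partialDeriv i (u j) x‖ ^ 2)
      atTop (𝓝 0))
    {q : ℝ} (hq : 9 / 2 < q)
    (hLq : ∃ C : ℝ, ∀ j, (∫ x, ‖u j x‖ ^ q) ≤ C ∧ (∫ x, |p j x| ^ (q / 2)) ≤ C) :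
    ¬ ∃ ε : ℝ, 0 < ε ∧ ∀ j, ε ≤ ν j * gradNormSq (u j) := by
  rintro ⟨ε, hε, hfl⟩
  obtain ⟨E, hEj⟩ := hE
  obtain ⟨C, hC⟩ := hLq
  have hE0 : 0 ≤ E := le_trans (integral_nonneg fun x => sq_nonneg _) (hEj 0)
  have hC0 : 0 ≤ C :=
    le_trans (integral_nonneg fun x => Real.rpow_nonneg (norm_nonneg _) _) (hC 0).1
  have hq0 : 0 < q := by linarith
  have hq3 : 3 < q := by linarith
  -- a bound for the force
  obtain ⟨Cf, hCf'⟩ := (isCompact_range hf.continuous.norm).bddAbove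
  have hCf : ∀ x, ‖f x‖ ≤ Cf := fun x => hCf' ⟨x, rfl⟩
  have hCf0 : 0 ≤ Cf := le_trans (norm_nonneg _) (hCf x₀)
  -- smoothness of the states
  have hu : ∀ j, IsSmooth (u j) := fun j =>
    (hsol j).smooth_velocity.isSmooth_slice (Set.mem_univ (0 : ℝ))
  have hp : ∀ j, IsSmooth (p j) := fun j =>
    (hsol j).smooth_pressure.isSmooth_slice (Set.mem_univ (0 : ℝ))
  -- `ν_j ‖∇u_j‖² ≤ Cf (1 + E) / 2` by the steady energy identity
  set KG : ℝ := Cf * (1 + E) / 2 with hKG_def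
  have hνG : ∀ j, ν j * gradNormSq (u j) ≤ KG := by
    intro j
    rw [CoherentStates.steady_energy_identity (hsol j)]
    have hU2i : Integrable (fun x => ‖u j x‖ ^ 2) volume := (hu j).norm_sq.integrable
    have hI : Integrable (fun x => Cf / 2 + Cf / 2 * ‖u j x‖ ^ 2) volume :=
      (integrable_const _).add (hU2i.const_mul _)
    have hle : ∫ x, ⟪f x, u j x⟫_ℝ ≤ ∫ x, (Cf / 2 + Cf / 2 * ‖u j x‖ ^ 2) := by
      refine integral_mono (hf.inner (hu j)).integrable hI fun x => ?_
      have h1 : ⟪f x, u j x⟫_ℝ ≤ ‖f x‖ * ‖u j x‖ := real_inner_le_norm _ _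
      have h2 : ‖f x‖ * ‖u j x‖ ≤ Cf * ‖u j x‖ :=
        mul_le_mul_of_nonneg_right (hCf x) (norm_nonneg _)
      have h3 : ‖u j x‖ ≤ (1 + ‖u j x‖ ^ 2) / 2 := by nlinarith [sq_nonneg (‖u j x‖ - 1)]
      have h4 : Cf * ‖u j x‖ ≤ Cf * ((1 + ‖u j x‖ ^ 2) / 2) := mul_le_mul_of_nonneg_left h3 hCf0
      linarith
    have heval : ∫ x, (Cf / 2 + Cf / 2 * ‖u j x‖ ^ 2) = Cf / 2 + Cf / 2 * ∫ x, ‖u j x‖ ^ 2 := by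
      rw [integral_add (integrable_const _) (hU2i.const_mul _), integral_const_mul, integral_const,
        smul_eq_mul, probReal_univ, one_mul]
    rw [heval] at hle
    have := hEj j
    rw [hKG_def]
    nlinarith
  -- the exponent `θ = 1 - 3/q`; the total error tends to `0` as `r → 0⁺` iff `3θ - 1 = 2 - 9/q > 0`
  set θ : ℝ := 1 - 3 / q with hθ_def
  have hθ0 : 0 < θ := by
    rw [hθ_def, sub_pos, div_lt_one hq0]; linarith
  have hexp : 0 < 3 * θ - 1 := by
    have h : 3 * θ - 1 = 2 - 9 / q := by rw [hθ_def]; ring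
    rw [h, sub_pos, div_lt_iff₀ hq0]; linarith
  have he_tend : Tendsto (fun r : ℝ => (3 / 2 * C ^ (3 / q)) * (r⁻¹ * (216 * r ^ 3) ^ θ) +
      Cf * Real.sqrt (216 * r ^ 3) * Real.sqrt E) (𝓝[>] 0) (𝓝 0) := by
    have h1 : Tendsto (fun r : ℝ => r ^ (3 * θ - 1)) (𝓝[>] 0) (𝓝 0) := by
      have hc := (Real.continuousAt_rpow_const 0 (3 * θ - 1) (Or.inr hexp.le)).tendsto
      rw [Real.zero_rpow hexp.ne'] at hc
      exact tendsto_nhdsWithin_of_tendsto_nhds hc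
    have h1' : Tendsto (fun r : ℝ => r⁻¹ * (216 * r ^ 3) ^ θ) (𝓝[>] 0) (𝓝 0) := by
      have heq : ∀ r : ℝ, 0 < r → r⁻¹ * (216 * r ^ 3) ^ θ = (216 : ℝ) ^ θ * r ^ (3 * θ - 1) := by
        intro r hr
        rw [Real.mul_rpow (by norm_num) (by positivity), ← Real.rpow_natCast r 3,
          ← Real.rpow_mul hr.le, Real.rpow_sub hr, Real.rpow_one]
        push_cast
        field_simp
      have h2 : Tendsto (fun r : ℝ => (216 : ℝ) ^ θ * r ^ (3 * θ - 1)) (𝓝[>] 0) (𝓝 0) := by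
        simpa using h1.const_mul ((216 : ℝ) ^ θ)
      refine h2.congr' ?_
      filter_upwards [self_mem_nhdsWithin] with r hr
      exact (heq r hr).symm
    have h3 : Tendsto (fun r : ℝ => Real.sqrt (216 * r ^ 3)) (𝓝[>] 0) (𝓝 0) := by
      have hc : Continuous fun r : ℝ => Real.sqrt (216 * r ^ 3) :=
        Real.continuous_sqrt.comp (continuous_const.mul (continuous_pow 3))
      have := hc.tendsto 0
      rw [show (216 : ℝ) * 0 ^ 3 = 0 by norm_num, Real.sqrt_zero] at this
      exact tendsto_nhdsWithin_of_tendsto_nhds this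
    have h4 := (h1'.const_mul (3 / 2 * C ^ (3 / q))).add
      ((h3.const_mul Cf).mul_const (Real.sqrt E))
    simpa using h4
  -- pick a radius `0 < r < 1` with total error `< ε / 4`
  obtain ⟨r, ⟨her, hr⟩, -⟩ : ∃ r : ℝ, ((3 / 2 * C ^ (3 / q)) * (r⁻¹ * (216 * r ^ 3) ^ θ) +
      Cf * Real.sqrt (216 * r ^ 3) * Real.sqrt E < ε / 4 ∧ 0 < r) ∧ r < 1 := by
    have hev1 : ∀ᶠ r : ℝ in 𝓝[>] (0 : ℝ), (3 / 2 * C ^ (3 / q)) * (r⁻¹ * (216 * r ^ 3) ^ θ) +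
        Cf * Real.sqrt (216 * r ^ 3) * Real.sqrt E < ε / 4 :=
      he_tend.eventually_lt_const (by linarith)
    have hev2 : ∀ᶠ r in 𝓝[>] (0 : ℝ), 0 < r := self_mem_nhdsWithin
    have hev3 : ∀ᶠ r in 𝓝[>] (0 : ℝ), r < 1 :=
      mem_nhdsWithin_of_mem_nhds (Iio_mem_nhds one_pos)
    exact ((hev1.and hev2).and hev3).exists
  -- the cut-off at scale `r` around the sink
  obtain ⟨χ, hχs, hχ01, hχ0, hχ1, hχD, hχD0⟩ :=
    ThinSetLiouville.exists_smooth_cutoff (fun x : UnitAddTorus (Fin 3) => dist x x₀)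
      (LipschitzWith.dist_left x₀) hr
  -- the weighted steady energy identity, term by term
  set FL : ℕ → ℝ := fun j => ∫ x, (2⁻¹ * ‖u j x‖ ^ 2 + p j x) * Torus.fderiv χ x (u j x)
    with hFL_def
  set T1 : ℕ → ℝ := fun j => ∫ x, χ x * ∑ i, ‖partialDeriv i (u j) x‖ ^ 2 with hT1_def
  set T2 : ℕ → ℝ := fun j => ∫ x, ∑ i, partialDeriv i χ x * ⟪u j x, partialDeriv i (u j) x⟫_ℝ
    with hT2_def
  set W : ℕ → ℝ := fun j => ∫ x, χ x * ⟪f x, u j x⟫_ℝ with hW_def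
  have hid : ∀ j, FL j = ν j * T1 j + ν j * T2 j - W j := fun j =>
    steady_weighted_energy_identity (hsol j) hχs
  -- (i) flux
  have hFL : ∀ j, |FL j| ≤ (3 / 2 * C ^ (3 / q)) * (r⁻¹ * (216 * r ^ 3) ^ θ) := fun j =>
    flux_abs_le_of_LqBound (hu j) (hp j) x₀ hr hχD hχD0 hq3 hC0 (hC j).1 (hC j).2
  -- (ii) weighted dissipation
  have hT1 : ∀ j, 0 ≤ ν j * T1 j ∧ ν j * T1 j ≤ ν j *
      ∫ x in {x : UnitAddTorus (Fin 3) | r / 2 ≤ dist x x₀}, ∑ i, ‖partialDeriv i (u j) x‖ ^ 2 := by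
    intro j
    have hF : IsSmooth (fun x => ∑ i, ‖partialDeriv i (u j) x‖ ^ 2) := by
      have h := ContDiff.sum (s := (Finset.univ : Finset (Fin 3)))
        (fun i (_ : i ∈ Finset.univ) => ((hu j).partialDeriv i).norm_sq)
      exact h
    have hF0 : ∀ x, 0 ≤ ∑ i, ‖partialDeriv i (u j) x‖ ^ 2 := fun x =>
      Finset.sum_nonneg fun i _ => sq_nonneg _
    have hAm : MeasurableSet {x : UnitAddTorus (Fin 3) | r / 2 ≤ dist x x₀} :=
      (isClosed_le continuous_const (continuous_id.dist continuous_const)).measurableSet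
    constructor
    · exact mul_nonneg (hν j).le (integral_nonneg fun x => mul_nonneg (hχ01 x).1 (hF0 x))
    · refine mul_le_mul_of_nonneg_left ?_ (hν j).le
      rw [← integral_indicator hAm]
      refine integral_mono (isSmooth_mul hχs hF).integrable (hF.integrable.indicator hAm) fun x => ?_
      by_cases hx : x ∈ {x : UnitAddTorus (Fin 3) | r / 2 ≤ dist x x₀}
      · rw [Set.indicator_of_mem hx]
        calc χ x * ∑ i, ‖partialDeriv i (u j) x‖ ^ 2 ≤ 1 * ∑ i, ‖partialDeriv i (u j) x‖ ^ 2 :=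
              mul_le_mul_of_nonneg_right (hχ01 x).2 (hF0 x)
          _ = _ := one_mul _
      · rw [Set.indicator_of_notMem hx]
        have hlt : dist x x₀ < r / 2 := by
          simp only [mem_setOf_eq, not_le] at hx; exact hx
        rw [hχ0 x hlt, zero_mul]
  -- (iii) viscous transport
  set L : ℝ := KG / 2 + 3 * E / (2 * r ^ 2) with hL_def
  have hT2 : ∀ j, |ν j * T2 j| ≤ Real.sqrt (ν j) * L := by
    intro j
    have h := viscousTransport_abs_le (hu j) hχs hr hχD (hν j)
    have hs0 : 0 ≤ Real.sqrt (ν j) := Real.sqrt_nonneg _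
    have hs2 : Real.sqrt (ν j) ^ 2 = ν j := Real.sq_sqrt (hν j).le
    have hs3 : Real.sqrt (ν j) ^ 3 * gradNormSq (u j) =
        Real.sqrt (ν j) * (ν j * gradNormSq (u j)) := by
      rw [show Real.sqrt (ν j) ^ 3 = Real.sqrt (ν j) ^ 2 * Real.sqrt (ν j) by ring, hs2]; ring
    have hr2 : 0 < r ^ 2 := by positivity
    have h1 := mul_le_mul_of_nonneg_left (hνG j) hs0
    have h2 := mul_le_mul_of_nonneg_left (hEj j) (div_nonneg hs0 hr2.le)
    calc |ν j * T2 j| ≤ Real.sqrt (ν j) ^ 3 * gradNormSq (u j) / 2 +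
          3 * ((Real.sqrt (ν j) / r ^ 2) * (∫ x, ‖u j x‖ ^ 2) / 2) := h
      _ = Real.sqrt (ν j) * (ν j * gradNormSq (u j)) / 2 +
          3 * ((Real.sqrt (ν j) / r ^ 2) * (∫ x, ‖u j x‖ ^ 2) / 2) := by rw [hs3]
      _ ≤ Real.sqrt (ν j) * KG / 2 + 3 * ((Real.sqrt (ν j) / r ^ 2) * E / 2) := by linarith
      _ = Real.sqrt (ν j) * L := by rw [hL_def]; ring
  -- (iv) work
  have hW : ∀ j, ε - Cf * Real.sqrt (216 * r ^ 3) * Real.sqrt E ≤ W j := by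
    intro j
    have hg : IsSmooth (fun x => (1 - χ x) • f x) := ((isSmooth_const (1 : ℝ)).sub hχs).smul' hf
    have hI1 : Integrable (fun x => ⟪f x, u j x⟫_ℝ) volume := (hf.inner (hu j)).integrable
    have hI2 : Integrable (fun x => ⟪(1 - χ x) • f x, u j x⟫_ℝ) volume :=
      (hg.inner (hu j)).integrable
    have hWsplit : W j = (∫ x, ⟪f x, u j x⟫_ℝ) - ∫ x, ⟪(1 - χ x) • f x, u j x⟫_ℝ := by
      rw [← integral_sub hI1 hI2]
      refine integral_congr_ae (ae_of_all _ fun x => ?_)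
      simp only [inner_smul_left, RCLike.conj_to_real]
      ring
    have hE1 : ε ≤ ∫ x, ⟪f x, u j x⟫_ℝ :=
      (hfl j).trans_eq (CoherentStates.steady_energy_identity (hsol j))
    have hE2 := workDefect_abs_le hf (hu j) hχs hχ01 x₀ hr hχ1 hCf0 hCf
    have hE3 : Cf * Real.sqrt (216 * r ^ 3) * Real.sqrt (∫ x, ‖u j x‖ ^ 2) ≤
        Cf * Real.sqrt (216 * r ^ 3) * Real.sqrt E := by
      gcongr
      exact hEj j
    rw [hWsplit]
    linarith [(abs_le.mp (hE2.trans hE3)).2]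
  -- assembly: a null sequence bounded below by `3ε/4`
  have hlim : Tendsto (fun j => ν j *
      (∫ x in {x : UnitAddTorus (Fin 3) | r / 2 ≤ dist x x₀}, ∑ i, ‖partialDeriv i (u j) x‖ ^ 2) +
      Real.sqrt (ν j) * L) atTop (𝓝 0) := by
    have h1 := hconc (r / 2) (by positivity)
    have h2 : Tendsto (fun j => Real.sqrt (ν j) * L) atTop (𝓝 0) := by
      have h := (Real.continuous_sqrt.tendsto 0).comp hν0
      rw [Real.sqrt_zero] at h
      simpa using h.mul_const L
    simpa using h1.add h2
  have hbig : ∀ j, 3 * ε / 4 ≤ ν j *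
      (∫ x in {x : UnitAddTorus (Fin 3) | r / 2 ≤ dist x x₀}, ∑ i, ‖partialDeriv i (u j) x‖ ^ 2) +
      Real.sqrt (ν j) * L := by
    intro j
    have h1 := hid j
    have h2 := abs_le.mp (hFL j)
    have h3 := hT1 j
    have h4 := abs_le.mp (hT2 j)
    have h5 := hW j
    linarith [h2.1, h2.2, h3.1, h3.2, h4.1, h4.2]
  have hev : ∀ᶠ j in atTop, ν j *
      (∫ x in {x : UnitAddTorus (Fin 3) | r / 2 ≤ dist x x₀}, ∑ i, ‖partialDeriv i (u j) x‖ ^ 2) +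
      Real.sqrt (ν j) * L < 3 * ε / 4 := hlim (Iio_mem_nhds (by linarith))
  obtain ⟨j, hj⟩ := hev.exists
  exact absurd (hbig j) (not_le.mpr hj)

/-- **The `L^q`-bounded strengthening of the target is false (`q > 9/2`).** Verbatim the clauses of
`PointSinkZerothLaw` plus `∃ q > 9/2, ∃ C, ∀ j, ∫‖u_j‖^q ≤ C ∧ ∫|p_j|^{q/2} ≤ C`: no witness. The
route's own transplanted soliton (`|u_j| ≍ dist^{-2/3}`) is uniformly in `L^q` exactly for
`q < 9/2`, so the exponent is sharp. [folklore] -/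
theorem not_pointSinkZerothLaw_LqBounded :
    ¬ (∃ f : UnitAddTorus (Fin 3) → EuclideanSpace ℝ (Fin 3), IsSmooth f ∧ IsDivFree f ∧
        HasZeroMean f ∧
      ∃ (x₀ : UnitAddTorus (Fin 3)) (ν : ℕ → ℝ)
        (u : ℕ → UnitAddTorus (Fin 3) → EuclideanSpace ℝ (Fin 3))
        (p : ℕ → UnitAddTorus (Fin 3) → ℝ), (∀ j, 0 < ν j) ∧ Filter.Tendsto ν Filter.atTop (nhds 0) ∧
        (∀ j, IsClassicalNSSolutionOn Set.univ (ν j) (fun _ => f) (fun _ => u j) (fun _ => p j)) ∧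
        (∃ E : ℝ, ∀ j, MeasureTheory.integral MeasureTheory.volume (fun x => ‖u j x‖ ^ 2) ≤ E) ∧
        (∃ ε : ℝ, 0 < ε ∧ ∀ j, ε ≤ ν j * gradNormSq (u j)) ∧
        (∀ r : ℝ, 0 < r → Filter.Tendsto (fun j => ν j *
          ∫ x in {x : UnitAddTorus (Fin 3) | r ≤ dist x x₀}, ∑ i, ‖partialDeriv i (u j) x‖ ^ 2)
          Filter.atTop (nhds 0)) ∧
        ∃ q : ℝ, 9 / 2 < q ∧ ∃ C : ℝ, ∀ j, (∫ x, ‖u j x‖ ^ q) ≤ C ∧ (∫ x, |p j x| ^ (q / 2)) ≤ C) := by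
  rintro ⟨f, hf, -, -, x₀, ν, u, p, hν, hν0, hsol, hE, hfloor, hconc, q, hq, hLq⟩
  exact pointSink_dissipationFloor_false_of_LqBound f hf x₀ ν u p hν hν0 hsol hE hconc hq hLq hfloor

end Summit.AnomalousDissipation.AnomalousDissipation.Theorems.SolitonTransplant.Negative

end
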